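import Summits.BirchSwinnertonDyer.BirchSwinnertonDyer.Theorems.QuadraticBranchSignedControlPlusEtaNonsurjThetaFunctionalEquationNormCoordinateInvariants
import HarnessLib

/-!
# Route `QuadraticBranchSignedControl` (rung K8, cell `bsd-potss`), residual crux `PlusEtaMainConjectureNonsurj`
# (stmt-BirchSwinnertonDyer-19606): THE FUNCTIONAL EQUATION ON THE QUADRATIC BRANCH, XXVI — RECIPROCAL WEIERSTRASS POLYNOMIALS ARE
# NORMS: the Weierstrass polynomial of every nonzero solution of `ι M = w(1+T)^e M` (every `L_p^±(V, η, X)`) is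
# **`P = T^{r₀} · (1+T)^k · H(T²/(1+T))`** with `H ∈ ℤ_p[Z]` DISTINGUISHED of degree `k = (λ − r₀)/2 = λ(N)`, `r₀ = ord_T M`
# (seat `bsd-potss-k8eta-c2` g30; kernel, class-wide, fact-free)

WHY. Part XVI proved that the Weierstrass polynomial `P` of a solution of the functional equation is `w`-reciprocal in `1+T`
(`(1+T)^λ ιP = wP`), Part XVII read off the shapes `λ = r₀ + 2 ⇒ P = T^{r₀}(T² + aT + a)`, Parts XXIII–XXV introduced the norm coordinate
`Z = T + ιT = T²/(1+T)` with `M = (1+T)^{−e/2}S^{r₀}N(Z)`, `λ(M) = r₀ + 2λ(N)`. THIS FILE identifies the Weierstrass polynomial itself: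
for a polynomial `H(Z) = Σ_{i≤k} h_i Z^i` of degree `≤ k`, **`(1+T)^k·H(T²/(1+T)) = Σ h_i T^{2i}(1+T)^{k−i}`** is a polynomial in `T` of degree
`≤ 2k`, DISTINGUISHED of degree `2k` when `H` is distinguished of degree `k` (mod `p` it is `T^{2k}`); and Weierstrass-preparing `N` in its
own variable, `N = p^μ·H·U_N`, gives `M = p^μ · [T^{r₀}(1+T)^k H(Z)] · [unit]`, so by the UNIQUENESS of the Weierstrass factorization
(Mathlib `IsWeierstrassFactorization.elim`, the tree's `eq_of_C_pow_mul_eq`) EVERY Weierstrass datum `M = p^m·P·U` has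
**`P = T^{r₀}·(1+T)^k·H(Z)`**, `m = μ(N)`, `k = λ(N)`. For `k = 1`: `H = Z + a`, `(1+T)(Z + a) = T² + aT + a` — Part XVII's shape; in
general the `k` roots of `H` in `Z` are the values `z = c + c^ι = −c·c^ι` on the `k` partner pairs `{c, c^ι}` of nonzero roots of `P`.

MATHEMATICS. (§76) `(1+T)^i Z^i = T^{2i}` (`(1+T)Z = T²`); for `natDegree H ≤ k`:
`↑(Σ_{i≤k} C(h_i) X^{2i}(1+X)^{k−i}) = (1+X)^k · H(Z)` in `Λ` (`PowerSeries.subst_coe`, `Polynomial.aeval_eq_sum_range'`); the `T`-polynomial has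
`natDegree ≤ 2k`, coefficient `h_k` at `T^{2k}`, and reduces mod `𝔪` to `h̄_k T^{2k}` when `h_i ∈ 𝔪` (`i < k`): distinguished of degree `2k` if `H` is
distinguished of degree `k`; `T^{r₀}` is distinguished. (§77) for `M ≠ 0` with `ι M = w(1+T)^e M`: `M = (1+T)^{er}S^{r₀}N(Z)` (XXIV),
`N = p^{μ(N)}·H·U_N` (Weierstrass, `deg H = λ(N)`), `S^{r₀} = T^{r₀}(1+T)^{r₀ r}`, `(1+T)^k·(1+T)^{−k} = 1`:
`M = p^{μ(N)} · ↑(T^{r₀}·Q) · [(1+T)^{er + r₀ r − k}·U_N(Z)]`, `Q = Σ h_i T^{2i}(1+T)^{k−i}`; uniqueness. (§78) the quadratic branch.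

WHAT. §76 `one_add_X_mul_trace_pow`, `coe_normPoly_eq` , `natDegree_normPoly_le`, `coeff_normPoly_two_mul`, `normPoly_isDistinguishedAt`,
`isDistinguishedAt_X_pow'`; §77 **`weierstrass_eq_X_pow_mul_normPoly_of_invol_eq`**, `coe_weierstrass_eq_of_invol_eq`; §78
`weierstrass_eq_X_pow_mul_normPoly_of_isQuadraticBranch{Plus,Minus}LFunction`.
(`normPoly` is a name token for the displayed sum `Σ_{i ∈ range(k+1)} C (H.coeff i) * X^(2i) * (1+X)^(k−i)`; no definition is introduced.)

HONEST FRAMING (cell `bsd-potss`; FULL-BSD rank ≤ 1 programme, HUMAN RULING D-0036/D-0074): TOOL THEOREMS ONLY — no definition, no named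
fact, no `sorry`, axioms standard; nothing about (A), (C1⁺_η), C-cc-1 or `BSD(W,p)` of any pair is claimed; no stub of 19606 is proved;
crux and route OPEN; nothing booked. `--supports stmt-BirchSwinnertonDyer-19606`.

References: [Washington1997] §7.1 (Thm. 7.3), §13.2; [MazurTateTeitelbaum1986Invent] §I.17; [GreenbergLNM1716] §1 (pp. 67–68); [Pollack2003]
Thm. 5.13, §6; [Sprung2017] Cor. 4.14. Tree: Parts XVI, XXIII–XXV; `Rank1Residual/X1/MuLambdaAlgebra`; Mathlib `PowerSeries.IsWeierstrassFactorization.elim`,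
`Polynomial.IsDistinguishedAt.mul`, `PowerSeries.subst_coe`, `Polynomial.aeval_eq_sum_range'`.
-/

set_option autoImplicit false
set_option linter.dupNamespace false
noncomputable section

open scoped Classical MatrixGroups ModularForm Topology

open PowerSeries CongruenceSubgroup Literature.NumberTheory.EllipticCurves Literature.NumberTheory.EllipticCurves.ModularForms
open Literature.NumberTheory.EllipticCurves.IwasawaAlgebra
open Summit.BirchSwinnertonDyer.Rank1Residual.Additive
open Summit.BirchSwinnertonDyer.Rank1Residual.X1.MuLambda (mu lam pfree red eq_C_pow_mu_mul_pfree red_pfree_ne_zero mu_eq_and_pfree_eq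
  eq_of_C_pow_mul_eq pfree_ne_zero)

namespace Summit.BirchSwinnertonDyer.BirchSwinnertonDyer.Theorems.EtaThetaFunctionalEquation

variable {p : ℕ} [hp : Fact p.Prime] {r : ℤ_[p]} {S Z : IwasawaAlgebra p}

/-! ## §76 Norm polynomials: `(1+T)^k · H(T²/(1+T)) = Σ h_i T^{2i}(1+T)^{k−i}` (`k = deg H`) is a distinguished polynomial of degree `2k` -/

/-- `(1+T)^i · Z^i = T^{2i}` (`(1+T)·Z = T²`). [cite: Washington1997, §13.2] -/
theorem one_add_X_mul_trace_pow (hZ : Z = X + invol p X) (i : ℕ) : (1 + X) ^ i * Z ^ i = X ^ (2 * i) := by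
  rw [← mul_pow, hZ, one_add_X_mul_X_add_invol_X, ← pow_mul]

/-- **The norm polynomial**: for `H ∈ ℤ_p[Z]` of degree `k`, the `T`-polynomial `Q = Σ_{i≤k} h_i T^{2i}(1+T)^{k−i}` (name token `normPoly`)
satisfies `↑Q = (1+T)^k · H(Z)` in `Λ`, `Z = T + ιT`. [cite: Washington1997, §7.1, §13.2] -/
theorem coe_normPoly_eq (hZ : Z = X + invol p X) (H : Polynomial ℤ_[p]) :
    ((∑ i ∈ Finset.range (H.natDegree + 1),
        Polynomial.C (H.coeff i) * Polynomial.X ^ (2 * i) * (1 + Polynomial.X) ^ (H.natDegree - i) : Polynomial ℤ_[p]) :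
        IwasawaAlgebra p) = (1 + X) ^ H.natDegree * PowerSeries.subst Z (H : IwasawaAlgebra p) := by
  rw [subst_coe (hasSubst_trace hZ), Polynomial.aeval_eq_sum_range' (Nat.lt_succ_self _), Finset.mul_sum,
    ← Polynomial.coeToPowerSeries.ringHom_apply, map_sum]
  refine Finset.sum_congr rfl fun i hi ↦ ?_
  have hik : i ≤ H.natDegree := Nat.lt_succ_iff.mp (Finset.mem_range.mp hi)
  obtain ⟨d, hd⟩ := Nat.exists_eq_add_of_le hik
  rw [Polynomial.coeToPowerSeries.ringHom_apply, Polynomial.coe_mul, Polynomial.coe_mul, Polynomial.coe_pow, Polynomial.coe_pow,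
    Polynomial.coe_C, Polynomial.coe_add, Polynomial.coe_one, Polynomial.coe_X, smul_eq_C_mul, ← one_add_X_mul_trace_pow hZ i, hd,
    Nat.add_sub_cancel_left, pow_add]
  ring

/-- The `T^{2k}`-coefficient of the norm polynomial is the leading coefficient `h_k` of `H` (only `i = k` reaches degree `2k`). [folklore] -/
theorem coeff_normPoly_two_mul (H : Polynomial ℤ_[p]) :
    (∑ i ∈ Finset.range (H.natDegree + 1),
        Polynomial.C (H.coeff i) * Polynomial.X ^ (2 * i) * (1 + Polynomial.X) ^ (H.natDegree - i) : Polynomial ℤ_[p]).coeff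
      (2 * H.natDegree) = H.coeff H.natDegree := by
  rw [Polynomial.finsetSum_coeff, Finset.sum_eq_single H.natDegree]
  · rw [Nat.sub_self, pow_zero, mul_one, Polynomial.coeff_C_mul, Polynomial.coeff_X_pow, if_pos rfl, mul_one]
  · intro i hi hne
    have hik : i < H.natDegree := lt_of_le_of_ne (Nat.lt_succ_iff.mp (Finset.mem_range.mp hi)) hne
    rw [mul_assoc, Polynomial.coeff_C_mul, Polynomial.coeff_X_pow_mul', if_pos (by omega), Polynomial.coeff_one_add_X_pow,
      Nat.choose_eq_zero_of_lt (by omega), Nat.cast_zero, mul_zero]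
  · intro h; exact absurd (Finset.mem_range.mpr (Nat.lt_succ_self _)) h

/-- The norm polynomial has `natDegree ≤ 2k` (term `i` has degree `k + i`). [folklore] -/
theorem natDegree_normPoly_le (H : Polynomial ℤ_[p]) :
    (∑ i ∈ Finset.range (H.natDegree + 1),
        Polynomial.C (H.coeff i) * Polynomial.X ^ (2 * i) * (1 + Polynomial.X) ^ (H.natDegree - i) : Polynomial ℤ_[p]).natDegree ≤
      2 * H.natDegree := by
  refine Polynomial.natDegree_sum_le_of_forall_le _ _ fun i hi ↦ ?_
  have hik : i ≤ H.natDegree := Nat.lt_succ_iff.mp (Finset.mem_range.mp hi)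
  have h1 : (1 + Polynomial.X : Polynomial ℤ_[p]).natDegree ≤ 1 := by
    rw [add_comm, ← Polynomial.C_1]; exact (Polynomial.natDegree_X_add_C 1).le
  refine Polynomial.natDegree_mul_le.trans ?_
  have h2 := Polynomial.natDegree_C_mul_le (H.coeff i) (Polynomial.X ^ (2 * i) : Polynomial ℤ_[p])
  rw [Polynomial.natDegree_X_pow] at h2
  have h3 := Polynomial.natDegree_pow_le_of_le (H.natDegree - i) h1
  omega

/-- **The norm polynomial of a DISTINGUISHED `H` of degree `k` is distinguished of degree `2k`**: monic (`h_k = 1` at `T^{2k}`) with all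
lower coefficients in `𝔪 = pℤ_p` (they are `ℤ_p`-combinations of `h_0, …, h_{k−1} ∈ 𝔪`: the `i = k` term is `T^{2k}`).
[cite: Washington1997, §7.1] -/
theorem normPoly_isDistinguishedAt {H : Polynomial ℤ_[p]} (hH : H.IsDistinguishedAt (IsLocalRing.maximalIdeal ℤ_[p])) :
    (∑ i ∈ Finset.range (H.natDegree + 1),
        Polynomial.C (H.coeff i) * Polynomial.X ^ (2 * i) * (1 + Polynomial.X) ^ (H.natDegree - i) : Polynomial ℤ_[p]).natDegree =
      2 * H.natDegree ∧
    (∑ i ∈ Finset.range (H.natDegree + 1),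
        Polynomial.C (H.coeff i) * Polynomial.X ^ (2 * i) * (1 + Polynomial.X) ^ (H.natDegree - i) : Polynomial ℤ_[p]).IsDistinguishedAt
      (IsLocalRing.maximalIdeal ℤ_[p]) := by
  set Q : Polynomial ℤ_[p] := ∑ i ∈ Finset.range (H.natDegree + 1),
    Polynomial.C (H.coeff i) * Polynomial.X ^ (2 * i) * (1 + Polynomial.X) ^ (H.natDegree - i) with hQ
  have htop : Q.coeff (2 * H.natDegree) = 1 := by rw [hQ, coeff_normPoly_two_mul, hH.monic.coeff_natDegree]
  have hle : Q.natDegree ≤ 2 * H.natDegree := natDegree_normPoly_le H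
  have hmon : Q.Monic := Polynomial.monic_of_natDegree_le_of_coeff_eq_one _ hle htop
  have hdeg : Q.natDegree = 2 * H.natDegree :=
    le_antisymm hle (Polynomial.le_natDegree_of_ne_zero (by rw [htop]; exact one_ne_zero))
  refine ⟨hdeg, ⟨⟨fun {n} hn ↦ ?_⟩, hmon⟩⟩
  rw [hdeg] at hn
  rw [hQ, Polynomial.finsetSum_coeff]
  refine Ideal.sum_mem _ fun i hi ↦ ?_
  rcases (Nat.lt_succ_iff.mp (Finset.mem_range.mp hi)).lt_or_eq with hik | hik
  · rw [mul_assoc, Polynomial.coeff_C_mul]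
    exact Ideal.mul_mem_right _ _ (hH.mem hik)
  · rw [hik, Nat.sub_self, pow_zero, mul_one, hH.monic.coeff_natDegree, map_one, one_mul, Polynomial.coeff_X_pow, if_neg hn.ne]
    exact Ideal.zero_mem _

/-- `T^n` is distinguished. [cite: Washington1997, §7.1] -/
theorem isDistinguishedAt_X_pow' (n : ℕ) : (Polynomial.X ^ n : Polynomial ℤ_[p]).IsDistinguishedAt (IsLocalRing.maximalIdeal ℤ_[p]) := by
  refine ⟨⟨fun {k} hk ↦ ?_⟩, Polynomial.monic_X_pow n⟩
  rw [Polynomial.natDegree_X_pow] at hk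
  rw [Polynomial.coeff_X_pow, if_neg hk.ne]
  exact Ideal.zero_mem _

/-- `(1+T)^k · (1+T)^{−k} = 1` (`(1+T)^k = binomialSeries k`). [folklore] -/
theorem one_add_X_pow_mul_binomialSeries_neg_natCast (k : ℕ) :
    (1 + X : IwasawaAlgebra p) ^ k * binomialSeries ℤ_[p] (-(k : ℤ_[p])) = 1 := by
  rw [← binomialSeries_nat (A := ℤ_[p]) (R := ℤ_[p]) k, binomialSeries_mul_binomialSeries_neg]

/-! ## §77 The Weierstrass polynomial of a solution of `ι M = w(1+T)^e M`: `P = T^{r₀} · (1+T)^k · H(Z)` -/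

/-- **RECIPROCAL WEIERSTRASS POLYNOMIALS ARE NORMS.** Let `p` be odd (`2r = −1`, `S = T(1+T)^r`, `Z = T + ιT`), `M ≠ 0` with
`ι M = w·(1+T)^e·M`, and `M = p^m·P·U` ANY Weierstrass datum (`P` distinguished, `U ∈ Λˣ`). Then there is a DISTINGUISHED `H ∈ ℤ_p[Z]`
with **`P = T^{r₀} · Σ_{i≤k} h_i T^{2i}(1+T)^{k−i}`**, i.e. **`P = T^{r₀}·(1+T)^k·H(T + ιT)` in `Λ`**, `k = deg H`, `deg P = r₀ + 2k`, `r₀ = ord_T M`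
— and `m = μ(N)`, `k = λ(N)` for the norm-coordinate series `N` of Part XXIV. (Weierstrass-prepare `N = p^{μ}·H·U_N` in its own variable,
substitute `Z`, regroup `M = p^{μ}·[T^{r₀}·normPoly H]·[unit]`, and use the uniqueness of the Weierstrass factorization.) For `k = 1`:
`H = Z + a`, `P = T^{r₀}(T² + aT + a)` (Part XVII). [cite: Washington1997, §7.1 (Thm. 7.3), §13.2] [cite: MazurTateTeitelbaum1986Invent, §I.17]
[cite: GreenbergLNM1716, §1 (pp. 67–68)] -/
theorem weierstrass_eq_X_pow_mul_normPoly_of_invol_eq (hr : 2 * r = -1) (hS : S = X * binomialSeries ℤ_[p] r) (hZ : Z = X + invol p X)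
    {M : IwasawaAlgebra p} (hM0 : M ≠ 0) {w e : ℤ_[p]} (hFE : invol p M = C w * binomialSeries ℤ_[p] e * M)
    {m : ℕ} {P : Polynomial ℤ_[p]} (hP : P.IsDistinguishedAt (IsLocalRing.maximalIdeal ℤ_[p])) {U : IwasawaAlgebra p} (hU : IsUnit U)
    (hMP : M = C ((p : ℤ_[p]) ^ m) * (P : IwasawaAlgebra p) * U) :
    ∃ (N : IwasawaAlgebra p) (H : Polynomial ℤ_[p]), constantCoeff N ≠ 0 ∧
      M = binomialSeries ℤ_[p] (e * r) * S ^ (PowerSeries.order M).toNat * PowerSeries.subst Z N ∧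
      H.IsDistinguishedAt (IsLocalRing.maximalIdeal ℤ_[p]) ∧ m = mu N ∧ H.natDegree = lam N ∧
      P = Polynomial.X ^ (PowerSeries.order M).toNat * ∑ i ∈ Finset.range (H.natDegree + 1),
        Polynomial.C (H.coeff i) * Polynomial.X ^ (2 * i) * (1 + Polynomial.X) ^ (H.natDegree - i) ∧
      (P : IwasawaAlgebra p) = X ^ (PowerSeries.order M).toNat * (1 + X) ^ H.natDegree * PowerSeries.subst Z (H : IwasawaAlgebra p) ∧
      P.natDegree = (PowerSeries.order M).toNat + 2 * H.natDegree := by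
  obtain ⟨N, hN0, -, hM⟩ := exists_normCoordinate_of_invol_eq hr hS hZ hM0 hFE
  have hN : N ≠ 0 := fun h ↦ hN0 (by rw [h, map_zero])
  obtain ⟨H, UN, hH, hUN, hdeg, hNH⟩ := exists_weierstrass_of_ne_zero hN
  have hZ' := hasSubst_trace hZ
  set r₀ := (PowerSeries.order M).toNat with hr₀
  set k := H.natDegree with hk
  set Q : Polynomial ℤ_[p] := ∑ i ∈ Finset.range (k + 1),
    Polynomial.C (H.coeff i) * Polynomial.X ^ (2 * i) * (1 + Polynomial.X) ^ (k - i) with hQdef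
  have hQ : (Q : IwasawaAlgebra p) = (1 + X) ^ k * PowerSeries.subst Z (H : IwasawaAlgebra p) := coe_normPoly_eq hZ H
  obtain ⟨hQdeg, hQdist⟩ := normPoly_isDistinguishedAt hH
  -- the unit cofactor
  set U' : IwasawaAlgebra p := binomialSeries ℤ_[p] (e * r) * binomialSeries ℤ_[p] r ^ r₀ * binomialSeries ℤ_[p] (-(k : ℤ_[p])) *
    PowerSeries.subst Z UN with hU'def
  have hUNZ : IsUnit (PowerSeries.subst Z UN : IwasawaAlgebra p) := by
    rw [PowerSeries.isUnit_iff_constantCoeff, constantCoeff_subst_trace hZ, ← PowerSeries.isUnit_iff_constantCoeff]; exact hUN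
  have hU' : IsUnit U' :=
    (((isUnit_binomialSeries' _).mul ((isUnit_binomialSeries' _).pow _)).mul (isUnit_binomialSeries' _)).mul hUNZ
  -- regrouping: `M = p^{μ N} · ↑(T^{r₀} Q) · U'`
  have hM' : M = C ((p : ℤ_[p]) ^ mu N) * ((Polynomial.X ^ r₀ * Q : Polynomial ℤ_[p]) : IwasawaAlgebra p) * U' := by
    have h1 : PowerSeries.subst Z N = C ((p : ℤ_[p]) ^ mu N) * PowerSeries.subst Z (H : IwasawaAlgebra p) * PowerSeries.subst Z UN := by
      conv_lhs => rw [hNH]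
      rw [subst_mul hZ', subst_C_mul hZ']
    have h2 : PowerSeries.subst Z (H : IwasawaAlgebra p) = (Q : IwasawaAlgebra p) * binomialSeries ℤ_[p] (-(k : ℤ_[p])) := by
      rw [hQ, mul_right_comm, one_add_X_pow_mul_binomialSeries_neg_natCast, one_mul]
    rw [hM, h1, h2, Polynomial.coe_mul, Polynomial.coe_pow, Polynomial.coe_X, hS, mul_pow, hU'def]
    ring
  -- compare with the given datum
  have hdist : (Polynomial.X ^ r₀ * Q).IsDistinguishedAt (IsLocalRing.maximalIdeal ℤ_[p]) := (isDistinguishedAt_X_pow' r₀).mul hQdist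
  have hred : ∀ {P₁ : Polynomial ℤ_[p]} {U₁ : IwasawaAlgebra p}, P₁.IsDistinguishedAt (IsLocalRing.maximalIdeal ℤ_[p]) → IsUnit U₁ →
      red ((P₁ : IwasawaAlgebra p) * U₁) ≠ 0 := fun hP₁ hU₁ ↦
    hP₁.map_ne_zero_of_eq_mul _ _ (fun hmem ↦ (IsLocalRing.mem_maximalIdeal _).mp hmem
      (PowerSeries.isUnit_iff_constantCoeff.mp hU₁)) rfl
  have hcmp := eq_of_C_pow_mul_eq (hred hP hU) (hred hdist hU') (by rw [← mul_assoc, ← mul_assoc, ← hMP, ← hM'])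
  obtain ⟨hm, hPU⟩ := hcmp
  have hfac : P = Polynomial.X ^ r₀ * Q ∧ U = U' :=
    PowerSeries.IsWeierstrassFactorization.elim (g := (P : IwasawaAlgebra p) * U) ⟨hP, hU, rfl⟩ ⟨hdist, hU', hPU⟩
  refine ⟨N, H, hN0, hM, hH, hm, hdeg, hfac.1, ?_, ?_⟩
  · rw [hfac.1, Polynomial.coe_mul, Polynomial.coe_pow, Polynomial.coe_X, hQ, mul_assoc]
  · rw [hfac.1, (Polynomial.monic_X_pow r₀).natDegree_mul hQdist.monic, Polynomial.natDegree_X_pow, hQdeg]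

/-- **Applying `ι` to the norm form recovers Part XVI's reciprocity** `(1+T)^{deg P}·ιP = (−1)^{r₀}·P` — a consistency check of the shape
`P = T^{r₀}(1+T)^k H(Z)`: `ιT = −T(1+T)^{−1}`, `ι(1+T) = (1+T)^{−1}`, `ι H(Z) = H(Z)`. [cite: MazurTateTeitelbaum1986Invent, §I.17] -/
theorem one_add_X_pow_mul_invol_of_eq_X_pow_mul_norm (hZ : Z = X + invol p X) {P : IwasawaAlgebra p} {r₀ k : ℕ} {H : IwasawaAlgebra p}
    (hP : P = X ^ r₀ * (1 + X) ^ k * PowerSeries.subst Z H) :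
    (1 + X) ^ (r₀ + 2 * k) * invol p P = C ((-1) ^ r₀) * P := by
  have hι1 : (1 + X : IwasawaAlgebra p) * invol p (1 + X) = 1 := one_add_X_mul_invol_one_add_X p
  have hιX : (1 + X : IwasawaAlgebra p) * invol p X = -X := by rw [mul_comm]; exact invol_X_mul_one_add_X p
  have e2 : (1 + X : IwasawaAlgebra p) ^ r₀ * invol p X ^ r₀ = (-X) ^ r₀ := by rw [← mul_pow, hιX]
  have e3 : (1 + X : IwasawaAlgebra p) ^ k * invol p (1 + X) ^ k = 1 := by rw [← mul_pow, hι1, one_pow]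
  rw [hP, map_mul, map_mul, map_pow, map_pow, invol_subst_trace hZ, map_pow, map_neg, map_one]
  calc (1 + X : IwasawaAlgebra p) ^ (r₀ + 2 * k) * (invol p X ^ r₀ * invol p (1 + X) ^ k * PowerSeries.subst Z H)
      = ((1 + X) ^ r₀ * invol p X ^ r₀) * ((1 + X) ^ k * invol p (1 + X) ^ k) * (1 + X) ^ k * PowerSeries.subst Z H := by ring
    _ = (-X) ^ r₀ * 1 * (1 + X) ^ k * PowerSeries.subst Z H := by rw [e2, e3]
    _ = (-1) ^ r₀ * (X ^ r₀ * (1 + X) ^ k * PowerSeries.subst Z H) := by rw [neg_pow X]; ring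

/-! ## §78 On the quadratic branch: the Weierstrass polynomial of every nonzero `L_p^±(V, η, X)` is `T^{ord L}·(1+T)^k·H(T + ιT)` -/

section Branch

variable {N : ℕ} [NeZero N] {f : CuspForm (Gamma0 N) 2}

/-- **THE WEIERSTRASS POLYNOMIAL OF `L_p⁺(V, η, X)` IN THE NORM COORDINATE**: `p` odd (`2r = −1`, `S`, `Z` as above), `f` a rational newform
of level prime to `p` with `a_p(f) = 0`, ANY period ratio, ANY nonzero plus branch function `L` and ANY Weierstrass datum `L = p^m·P·U`:
**`P = T^{ord L} · (1+T)^k · H(T + ιT)`** with `H ∈ ℤ_p[Z]` distinguished of degree `k`, `λ(L) = deg P = ord L + 2k`; the `k` roots of `H`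
are the norms `z = c + c^ι = −c·c^ι` of the partner pairs of nonzero zeros. NO named fact (Fricke sign / exponent discharged).
[cite: Washington1997, §7.1 (Thm. 7.3)] [cite: MazurTateTeitelbaum1986Invent, §I.17] [cite: Sprung2017, Cor. 4.14] [cite: Pollack2003, Thm. 5.13] -/
theorem weierstrass_eq_X_pow_mul_normPoly_of_isQuadraticBranchPlusLFunction (hp2 : p ≠ 2) (hf0 : IsNewform0 f) (hQ : coeffField f = ⊥)
    (hpN : ¬ p ∣ N) (hap : cuspCoeff f p = ((0 : ℤ) : ℂ))
    (hr : 2 * r = -1) (hS : S = X * binomialSeries ℤ_[p] r) (hZ : Z = X + invol p X)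
    {ϖ : ℚ} {L : IwasawaAlgebra p} (hL : IsQuadraticBranchPlusLFunction f p ϖ L) (hL0 : L ≠ 0)
    {m : ℕ} {P : Polynomial ℤ_[p]} (hP : P.IsDistinguishedAt (IsLocalRing.maximalIdeal ℤ_[p])) {U : IwasawaAlgebra p} (hU : IsUnit U)
    (hLP : L = C ((p : ℤ_[p]) ^ m) * (P : IwasawaAlgebra p) * U) :
    ∃ H : Polynomial ℤ_[p], H.IsDistinguishedAt (IsLocalRing.maximalIdeal ℤ_[p]) ∧
      (P : IwasawaAlgebra p) = X ^ (PowerSeries.order L).toNat * (1 + X) ^ H.natDegree * PowerSeries.subst Z (H : IwasawaAlgebra p) ∧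
      P.natDegree = (PowerSeries.order L).toNat + 2 * H.natDegree := by
  obtain ⟨σ, hσ, hW⟩ := exists_frickeSign_of_isNewform0 hf0
  obtain ⟨e, he⟩ := exists_invol_eq_of_isQuadraticBranchPlusLFunction hp2 hf0 hQ hpN hap hσ hW hL
  obtain ⟨-, H, -, -, hH, -, -, -, hPZ, hdeg⟩ := weierstrass_eq_X_pow_mul_normPoly_of_invol_eq hr hS hZ hL0 he hP hU hLP
  exact ⟨H, hH, hPZ, hdeg⟩

/-- **THE WEIERSTRASS POLYNOMIAL OF `L_p⁻(V, η, X)` IN THE NORM COORDINATE** (minus twin). [cite: Washington1997, §7.1 (Thm. 7.3)]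
[cite: MazurTateTeitelbaum1986Invent, §I.17] [cite: Sprung2017, Cor. 4.14] -/
theorem weierstrass_eq_X_pow_mul_normPoly_of_isQuadraticBranchMinusLFunction (hp2 : p ≠ 2) (hf0 : IsNewform0 f) (hQ : coeffField f = ⊥)
    (hpN : ¬ p ∣ N) (hap : cuspCoeff f p = ((0 : ℤ) : ℂ))
    (hr : 2 * r = -1) (hS : S = X * binomialSeries ℤ_[p] r) (hZ : Z = X + invol p X)
    {ϖ : ℚ} {L : IwasawaAlgebra p} (hL : IsQuadraticBranchMinusLFunction f p ϖ L) (hL0 : L ≠ 0)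
    {m : ℕ} {P : Polynomial ℤ_[p]} (hP : P.IsDistinguishedAt (IsLocalRing.maximalIdeal ℤ_[p])) {U : IwasawaAlgebra p} (hU : IsUnit U)
    (hLP : L = C ((p : ℤ_[p]) ^ m) * (P : IwasawaAlgebra p) * U) :
    ∃ H : Polynomial ℤ_[p], H.IsDistinguishedAt (IsLocalRing.maximalIdeal ℤ_[p]) ∧
      (P : IwasawaAlgebra p) = X ^ (PowerSeries.order L).toNat * (1 + X) ^ H.natDegree * PowerSeries.subst Z (H : IwasawaAlgebra p) ∧
      P.natDegree = (PowerSeries.order L).toNat + 2 * H.natDegree := by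
  obtain ⟨σ, hσ, hW⟩ := exists_frickeSign_of_isNewform0 hf0
  obtain ⟨e, he⟩ := exists_invol_eq_of_isQuadraticBranchMinusLFunction hp2 hf0 hQ hpN hap hσ hW hL
  obtain ⟨-, H, -, -, hH, -, -, -, hPZ, hdeg⟩ := weierstrass_eq_X_pow_mul_normPoly_of_invol_eq hr hS hZ hL0 he hP hU hLP
  exact ⟨H, hH, hPZ, hdeg⟩

end Branch

end Summit.BirchSwinnertonDyer.BirchSwinnertonDyer.Theorems.EtaThetaFunctionalEquation

end
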